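import Mathlib
import HarnessLib
import HarnessLib.Audit
import Summits.KontsevichZagierPeriods.Statement
import Literature.NumberTheory.Transcendental.KZProductIdeal
import Literature.NumberTheory.Transcendental.MZVDualIndex
import Literature.NumberTheory.Transcendental.MultipleZetaStuffle
import Literature.NumberTheory.Transcendental.AyoubPeriodSeries
import HarnessLib.Audit.Status.Attr

/-!
Route: CoactionDevissage

DORMANT since 2026-08-24T15:50:51Z (reconciler: no traction for 6.9 d (last activity item-evidence-added at 2026-08-17T18:17:02Z); parked, not closed — `ledger route dormant route-KontsevichZagierPeriods-CoactionDevissage --off` to reac) — unstaffed, not closed; items shared with open routes are served there. `ledger route dormant <id> --off` reactivates.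

# Route CoactionDevissage — P_KZ is a ℚ-space; 'rules ≡ motives' on the MZV sector becomes the typed
Hoffman-span statement (Brown's coaction theorem as dévissage)

It suffices to show X = TorsionFree ∧ RationalKernel. TorsionFree: the effective period group of the
KZ calculus
P_KZ := KZ.FormalRep ⧸ KZ.relations is torsion-free (n • c ∈ relations, n ≠ 0 ⇒ c ∈ relations) —
provable now from the
PROVED ideal property `KZ.mul_mem_relations_right_holds` by cutting an auxiliary unit interval into
n slabs; with Divisible,
P_KZ is a ℚ-vector space (card kz-coaction-devissage, item D0). RationalKernel: the period
conjecture for P_KZ ⊗ ℚ — every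
vanishing ℤ-combination of integral representations has a non-zero integer multiple in KZ.relations;
this is the form in
which every ℚ-linear / motivic method (Nori, Brown's coaction) delivers relations, attacked sector
by sector: on the mixed
Tate sector Brown's Hoffman-basis theorem (proved by coaction dévissage) converts "do KZ's rules
give all MOTIVIC relations
among MZV representations?" (HuberMullerStach2017 Rem. 13.1.8) into the typed crux HoffmanSpan, with
the regularisation
pressure point isolated in HoffmanRegularisation and the pure part in EulerBasel. Realises card
kz-coaction-devissage
(D0 = TorsionFree/Divisible, D2/D3 recast as HoffmanSpan/EulerBasel, D1 as the informal crux
GoncharovCoideal filed after open).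
Lean: `(∀ (n : ℕ) (c : Literature.NumberTheory.Transcendental.KZ.FormalRep), n ≠ 0 → n • c ∈
Literature.NumberTheory.Transcendental.KZ.relations → c ∈
Literature.NumberTheory.Transcendental.KZ.relations) ∧ (∀ c :
Literature.NumberTheory.Transcendental.KZ.FormalRep, Literature.NumberTheory.Transcendental.KZ.eval
c = 0 → ∃ n : ℕ, n ≠ 0 ∧ n • c ∈ Literature.NumberTheory.Transcendental.KZ.relations)`

## Assembly
Pure logic (checked sorry-free in Sketch.lean): given c with KZ.eval c = 0, RationalKernel gives n ≠
0 with n • c ∈ relations,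
TorsionFree gives c ∈ relations, i.e. `KZKernelConjecture`; then
`Summit.KontsevichZagierPeriods.KernelForm.kontsevichZagierPeriods_of_kzKernelConjecture`
(Theorems/KernelFormKernelImpliesStatement.lean) gives the summit. The sector items feed
RationalKernel restricted to the MZV span (SectorAssembly).

Rationale: WHY THIS LINE. The card's coaction dévissage, taken literally (a coaction Δ_KZ on P_KZ and
"injective iff injective on invariants"), is
circular at the invariants of a presented group; what survives is (i) the saturation lemma
TorsionFree/Divisible — P_KZ is
a ℚ-space although "no division by integers is a rule" (summit docstring, reading 2;
KontsevichZagier2001 §1.2) — and (ii)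
Brown's theorem (Brown2012 Thm 1.1, motivic MZVs via the Goncharov–Brown coaction, arXiv:1102.1310)
used as the dévissage
ENGINE on the motivic side: it makes "rules ≡ motives on MT(ℤ)" equivalent to the concrete,
weight-graded, typed statement
HoffmanSpan, with transcendence quarantined in one explicit hypothesis (ℚ-independence of real
Hoffman MZVs ⟺ Zagier's
conjecture given Brown) — unlike route Grothendieck's informal 0277 (ZagierConjecture →
DoubleShuffleInKZ → sector), which
silently needs completeness of extended double shuffle. Finite double shuffle is rules-derivable
with absolutely convergent
intermediates by Soudères' cubical blow-up coordinates and positive partial fractions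
(arXiv:0808.0248 §1.2–1.3, after
Goncharov and Brown's thesis), so the regularisation doubt of HuberMullerStach2017 Rem. 13.1.8 /
route Neg (a) shrinks to
Hoffman's relation family (Hoffman1992 Thm 5.1; IharaKanekoZagier2006). Imported areas: mixed Tate
motives / Hopf-algebraic
combinatorics of MZVs (Brown, Goncharov, Hoffman, IKZ) for the targets; real semialgebraic geometry
of the moves for proofs.

RANKED CRUXES. #0 RationalKernel (target) — the Kontsevich–Zagier conjecture with ℚ-coefficients:
every c : KZ.FormalRep with KZ.eval c = 0 has some n ≠ 0 with n • c ∈ KZ.relations (injectivity of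
P_KZ ⊗ ℚ → ℝ); ⟺ S given TorsionFree. (why it might fail: Period-conjecture strength (⟺ S by
TorsionFree): false as soon as the fixed 4-move calculus misses one motivic relation
(HuberMullerStach2017 Rem 13.1.8) — route Neg's bet.) [KontsevichZagier2001, HuberMullerStach2017,
Ayoub2014, Brown2012]
#2 HoffmanSpan (crux) — 'rules ≡ motives' on the MZV sector in Hoffman form: for every admissible
index s there are N ≠ 0 and a finite ℤ-combination of simplex representations mzvRep t of Hoffman
indices t ∈ {2,3}^× of the same weight with N • [mzvRep s] − Σ b_t • [mzvRep t] ∈ KZ.relations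
(Brown2012 Thm 1.1 guarantees the real/motivic decomposition; the crux is that the four moves
realise it). Card items D2/D3 recast. [deps: HoffmanRegularisation, Stuffle, Shuffle, Duality]
[difficulty: open-problem] (why it might fail: Rules may be weaker than motives (HMS Rem 13.1.8):
beyond finite double shuffle every known engine regularises divergent words, and even granting all
of EDS inside KZ, 'EDS ⇒ Hoffman words span' is open combinatorics (computer-checked only to weight
≈ 20).) [Brown2012, arXiv:1102.1310, HuberMullerStach2017, IharaKanekoZagier2006, Hoffman1997,
arXiv:2406.13630, KontsevichZagier2001]
#3 HoffmanRegularisation (crux) — Hoffman's relation family lies in KZ.relations: for every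
admissible s = (s₁,…,s_k) (decreasing convention of `multipleZeta`), Σ_l [ζ-rep(s₁,…,s_l+1,…,s_k)] −
Σ_l Σ_{j ≤ s_l−2} [ζ-rep(s₁,…,s_{l−1}, s_l−j, j+1, s_{l+1},…,s_k)] ∈ KZ.relations (Hoffman1992 Thm
5.1; = IKZ's regularised double shuffle with v = y₁). Instances: s=(2): ζ(3)=ζ(2,1); s=(3):
ζ(4)=ζ(3,1)+ζ(2,2); s=(2,1): ζ(2,1,1)=ζ(3,1)+ζ(2,2). [deps: Duality, Shuffle, Stuffle] [difficulty:
L] (why it might fail: Every printed proof regularises ζ(1) or rearranges series (Hoffman1992 Thm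
5.1, IKZ2006); a move-proof needs a convergent Stokes detour. First live instance
ζ(4)=ζ(3,1)+ζ(2,2): in weight 4 finite double shuffle + duality yield only 2 of the 3 rational
relations.) [Hoffman1992, IharaKanekoZagier2006, arXiv:2406.13630, doi:10.5802/jep.335,
KontsevichZagier2001]
#4 EulerBasel (crux) — Euler's ζ(2) = π²/6 inside the calculus: 6 • [ζ(2)-simplex rep] −
[disc]·[disc] ∈ KZ.relations, where [disc] = KZ.piRep (closed unit disc, integrand 1) and · is the
product of representations (KZProduct). The pure/invariant part of the sector (card D3): it ties the
MZV fragment to the [π]-powers of the rest of P_KZ. [difficulty: M] (why it might fail: KZ2001 §1.2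
prove I = π²/2 for I = ∫∫(xy)^{-1/2}(1−xy)^{-1} by rules but identify I = 3ζ(2) by a SERIES
expansion; the residual accessible identity ∫∫_{[0,1]²}(1−3uv)/(1−u²v²) = 0 and the arctan ↔
sector-area steps must themselves be moves.) [KontsevichZagier2001, BeukersCalabiKolk1993,
paper:url-4812d7ce6862]
#9 TorsionFree (support) — P_KZ is torsion-free: n ≠ 0, n • c ∈ KZ.relations ⇒ c ∈ KZ.relations.
Proof: c − c·[0,1] ∈ relations (Newton–Leibniz on each generator r with base r, band r.domain ×
[0,1] = (r.prod I₀₁).domain, F(x,t) = t·f(x)); c·[0,1] − n • (c·[0,1/n]) ∈ relations (domain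
additivity into n slabs over the null overlaps r.domain × {k/n}, translations t ↦ t − k/n as changes
of variables); n • (c·[0,1/n]) = (n • c)·[0,1/n] ∈ relations by `KZ.mul_mem_relations_right_holds`.
Card item D0. [difficulty: provable-now] [KontsevichZagier2001,
Literature.NumberTheory.Transcendental.KZ.mul_mem_relations_right_holds,
Literature.NumberTheory.Transcendental.KZ.of_mul_of]
#9 Divisible (support) — P_KZ is divisible: for n ≠ 0 every c has c' with c − n • c' ∈ KZ.relations
(c' := c·[0,1/n]; same two steps as TorsionFree). With TorsionFree, P_KZ is uniquely divisible, i.e.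
a ℚ-vector space — so ℚ-linear transfer maps (route NoriTransfer, refuted when typed into the free
group FormalRep: Theorems/NoriTransferRefutations.lean) can target P_KZ instead. [difficulty:
provable-now] [KontsevichZagier2001,
Literature.NumberTheory.Transcendental.KZ.mul_mem_relations_right_holds]
#9 Duality (support) — duality is one move: [mzvRep s] − [mzvRep (dual s)] ∈ KZ.relations by the
change of variables tᵢ ↦ 1 − t_{w−1−i} of the open ordered simplex (|det| = 1;
`MultipleZetaDuality.dualMap`), which swaps ω₀ ↔ ω₁ and reverses the word. Gives ζ(3) = ζ(2,1),
ζ(2,1,1) = ζ(4), … as KZ-equivalences. [difficulty: provable-now] [Zagier1994,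
Literature.NumberTheory.Transcendental.multipleZeta_dual,
Literature.NumberTheory.Transcendental.KZ.measurePreserving_dualMap]
#9 Shuffle (support) — the shuffle product is realised by moves: [mzvRep s]·[mzvRep t] − Σ_{w ∈
sh(word s, word t)} [mzvRep (index of w)] ∈ KZ.relations — product rep = rep on Δ_p × Δ_q
(KZ.of_mul_of), domain additivity into the simplices indexed by shuffles (pairwise overlaps
Lebesgue-null), coordinate permutations as changes of variables (arXiv:0808.0248 §1.2; the real
identity is `multipleZeta_mul_eq_sum_shuffleWord`). [difficulty: provable-now] [arXiv:0808.0248,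
Literature.NumberTheory.Transcendental.multipleZeta_mul_eq_sum_shuffleWord, KontsevichZagier2001]
#9 Stuffle (support) — the stuffle (harmonic) product is realised by moves with absolutely
convergent intermediates: [mzvRep s]·[mzvRep t] − Σ_{u ∈ stuffle s t} [mzvRep u] ∈ KZ.relations, by
Soudères' recipe (arXiv:0808.0248 Prop 1.3, 1.5, Cor 1.6, after Goncharov and Brown's thesis): the
cubical blow-up change of variables t_n = x₁, t_{n−1} = x₁x₂, … (polynomial, injective on the open
cube, polynomial Jacobian) turns ζ-reps into cube integrals of f_k; the pointwise identity f_k(x)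
f_l(x') = Σ_σ f_σ(y_σ) with ALL summands positive is integrand additivity; permuting variables is a
change of variables; back to simplices by the inverse blow-up. Contains route Grothendieck's 0275
(ζ(2)∗ζ(2)) combined with Shuffle. [difficulty: L] [arXiv:0808.0248, doi:10.1142/s1793042110002995,
Hoffman1997, Literature.NumberTheory.Transcendental.multipleZeta_mul]
#9 SectorAssembly (support) — the MZV-sector theorem with transcendence isolated: HoffmanSpan →
TorsionFree → (the real Hoffman values ζ(t), t ∈ {2,3}^×, are ℚ-linearly independent; ⟺ Zagier's
conjecture given Brown2012) → every c in the subgroup of FormalRep generated by the simplex reps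
[mzvRep s] with KZ.eval c = 0 lies in KZ.relations. Pure algebra: multiply c by the product of the
N's, rewrite in Hoffman reps mod relations, evaluate with `KZ.mzvRep_value_holds` and
`KZ.relations_le_ker_eval_holds`, kill the integer coefficients by independence, divide by
TorsionFree. [difficulty: provable-now] [Brown2012, ZagierECM1994,
Literature.NumberTheory.Transcendental.KZ.mzvRep_value_holds,
Literature.NumberTheory.Transcendental.KZ.relations_le_ker_eval_holds]

TWO-LAYER PLAN. Foreseen glued splits (none filed now): HoffmanSpan ⇐ ExtendedDoubleShuffleInKZ (all
IKZ/REDS generators u ш v − u ∗ v, u ∈ 𝔥⁰, v ∈ 𝔥¹,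
by moves; HoffmanRegularisation is its v = y₁ slice) → EDSHoffmanCompleteness (combinatorial: the
REDS quotient is spanned by Hoffman
words in each weight; open, computer-checked in low weight) → HoffmanSpan. HoffmanRegularisation ⇐
weight ≤ 5 instances → a uniform
convergent-Stokes template (log-corner style, doi:10.5802/jep.335) → HoffmanRegularisation.
EulerBasel ⇐ OneDimArctanNormalForm (shared
with route LowDimension #2: ∫dξ/(1+ξ²)-reps ~ quarter-disc areas) → AccessibleIdentity2D
(∫∫(1−3uv)/(1−u²v²) = 0 and KZ's ξ,η-substitution
by moves) → EulerBasel.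

KILL CRITERIA. Each of HoffmanSpan (instance-wise), HoffmanRegularisation (any instance, first s =
(3) or (2,1)), EulerBasel, Duality, Shuffle, Stuffle asserts a
KZ-equivalence between representations whose values are ALREADY PROVED equal in the tree
(multipleZeta_dual, multipleZeta_mul,
multipleZeta_mul_eq_sum_shuffleWord, multipleZeta_two_one_one_eq_add, hasSum_zeta_two via
KZ.mzvRep_value_holds); hence a refutation of any of
them (an additive invariant of FormalRep vanishing on the four move sets and separating the pair,
Neg 0313 shape) refutes KZKernelConjecture
and the summit outright: close `refuted:<Decl>`, hand the witness to route Neg, all positive routes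
die. ¬TorsionFree or ¬Divisible cannot
happen short of a defect of the calculus (S ⇒ TorsionFree): report to the operator. HoffmanSpan
proved for all s together with NoriTransfer's
relator half would moot GoncharovCoideal. The route is superseded if NoriTransfer's transfer Φ
(re-typed into P_KZ ⊗ ℚ) lands in full.

NOT DECOMPOSED YET. Weight-by-weight children of HoffmanSpan (w ≤ 7 from
Shuffle+Stuffle+Duality+HoffmanRegularisation by finite linear algebra; the
Zagier–Brown family ζ(2^a 3 2^b) = Σ_r c_{a,b,r} ζ(2r+1) ζ(2^{a+b+1−r}) as the level-lowering ladder
Brown's proof consumes); the full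
REDS family (v ∈ 𝔥¹ beyond y₁); Euler's ζ(2n) ∈ ℚπ^{2n} family beyond n = 1; other alphabets
(hyperlogarithms at algebraic points, roots
of unity); the coaction-proper structural statement GoncharovCoideal (filed informal after open,
with a definition request for
Goncharov's Hopf algebra of formal iterated integrals); the NoriTransfer repair via
TorsionFree/Divisible (that route's planner).

CHEAPEST FALSIFIER. Weight-4 audit, doable on paper: with Shuffle, Stuffle, Duality (support) the
KZ-derivable ℤ-relations among [ζ(4)], [ζ(3,1)], [ζ(2,2)],
[ζ(2,1,1)] have rank 2 (ζ(4) = 4ζ(3,1), ζ(2,1,1) = ζ(4)); HoffmanSpan in weight 4 needs rank 3. So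
the single identity
[mzvRep (2,1,1)] − [mzvRep (3,1)] − [mzvRep (2,2)] ∈ KZ.relations (HoffmanRegularisation at s =
(2,1), equivalently Euler's
ζ(4) = ζ(3,1) + ζ(2,2) at s = (3)) is the cheapest live test: a refuter's additive invariant
separating it kills HoffmanRegularisation,
HoffmanSpan and the summit at once; a prover's explicit chain settles weight 4 of HoffmanSpan
completely. Second: elaborate and prove
TorsionFree (a day): if the Newton–Leibniz side conditions for F = t·f(x) on r.domain × [0,1] cannot
be met for some admissible r, the
calculus has a defect to report, not a theorem.

NUMBERS. Zagier dimensions d_w (w = 0..12): 1,0,1,1,1,2,2,3,4,5,7,9,12 (`zagierDim`); admissible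
indices of weight w: 2^{w−2}; Hoffman words of
weight w: d_w (`zagierDim_eq_card_hoffman`). Weight 4: indices (4),(3,1),(2,2),(2,1,1), Hoffman word
(2,2); ζ(2,2) = (3/4)ζ(4), ζ(3,1) = ζ(4)/4,
ζ(2,1,1) = ζ(4) = π⁴/90 (tree: multipleZeta_two_one_one). Weight 5 (convention n₁ > n₂): ζ(3,2) =
3ζ(2)ζ(3) − (11/2)ζ(5) ≈ 0.22881,
ζ(2,3) = (9/2)ζ(5) − 2ζ(2)ζ(3) ≈ 0.71157, check ζ(3,2)+ζ(2,3)+ζ(5) = ζ(2)ζ(3) ≈ 1.97730.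
EDS-completeness (dim ≤ d_w from extended double
shuffle) is computer-verified to weight ≈ 20 only (IharaKanekoZagier2006 and the MZV data mine
arXiv:0907.2557). Items at open: 11
(1 target, 3 typed cruxes, 6 support, 1 assembly); + 1 informal crux and 1 definition request filed
after open.

DEFINITION REQUESTS. GoncharovFormalIteratedIntegrals (Literature/NumberTheory/Transcendental):
Goncharov's graded Hopf algebra 𝓘_•(S) of formal iterated
integrals 𝕀(a₀; a₁,…,a_n; a_{n+1}), aᵢ ∈ S, modulo path composition, shuffle, triviality and
reversal, with the coproduct
Δ𝕀(a₀;…;a_{n+1}) = Σ 𝕀(a₀; a_{i₁},…,a_{i_k}; a_{n+1}) ⊗ Π_p 𝕀(a_{i_p}; a_{i_p+1},…; a_{i_{p+1}})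
(arXiv:math/0208144 §2), its
regularised quotient for S = {0,1} identified with (𝔥⁰, ш) (IharaKanekoZagier2006), and Brown's
comodule variant over A = H/(ζ^m(2))
(arXiv:1102.1312 §2) — needed to type the informal crux GoncharovCoideal: "the kernel of 𝔥⁰_ℚ → P_KZ
⊗ ℚ, w ↦ [mzvRep w], is a Hopf
(co)ideal; hence (Hopf–Leray) the MZV fragment of P_KZ ⊗ ℚ is a polynomial algebra, in particular an
integral domain
(Ayoub2014 Cor. 32 sector-wise)". No other notion is missing: mzvRep, stuffle, shuffleWord, dual,
piRep, FormalRep products all exist.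

Novelty: Searches (2026-08-15): `lit search --hybrid "Kontsevich-Zagier period conjecture multiple zeta
values Hoffman basis motivic relations rules"`
(12 docs: HuberWustholz2022, HMS, Marcolli, CDM2012 …; none on a rules-level MZV sector or on
torsion of the rules quotient);
`lit search --source zbmath "motivic double shuffle multiple zeta values"` (9: Soudères
arXiv:0808.0248, Brown arXiv:1301.3053, AGZT
arXiv:2406.13630, Zhao, Huang t-motivic, …); `lit search --source zbmath "Kontsevich-Zagier period
conjecture multiple zeta values integral
representation rules"` (1: Viu-Sos arXiv:1509.01097); `lit search --source crossref "abstract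
periods torsion free divisible effective period
ring Kontsevich"` (0 relevant); `lit galaxy search --star all "Kontsevich-Zagier conjecture"` and
`"period conjecture of Kontsevich and Zagier"`
(0 + 0); `lit galaxy search --star pdf "motivic multiple zeta values"` (12: Brown arXiv:1102.1310
and 1102.1312, Keilthy thesis, Machide
arXiv:2205.13751 on binary-EDS formal spaces, Soudères cycles); `lit frontier
KontsevichZagierPeriods --since 2020` (30: doi:10.5802/jep.335
regularised integrals with log corners, "A polynomial basis for the stuffle algebra" 2026,
arXiv:2302.07650); `lit bridges --cross any`;
read: arXiv:0808.0248 pp. 3–5, KontsevichZagier2001 pp. 8–10 (paper:url-4812d7ce6862),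
arXiv:2406.13630 pp. 78–80; in tree: route
Grothendieck items 0275/0277, Neg, NoriTransferRefutations, card kz-coaction-devissage audit.
Nearest prior art found: Kontsevi  [refs: 10.5802/jep.335, 0808.0248, 1301.3053, 2406.13630, 1509.01097, 1102.1310, 2205.13751, 2302.07650, doi:10.5802/jep.335, paper:url-4812d7ce6862, HuberWustholz2022, KontsevichZagier2001, HuberMullerStach2017, Brown2012, IharaKanekoZagier2006]

Barriers (technique_class: coaction-devissage, mzv-sector-transfer, torsion): - technique_class: coaction-devissage, mzv-sector-transfer, torsion
- Literature.Barriers.KontsevichZagierPeriods.kzConjecture_implies_oddZetaAlgIndep: not engaged by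
the cruxes — HoffmanSpan, HoffmanRegularisation, EulerBasel, Duality, Shuffle, Stuffle, TorsionFree
assert KZ-equivalences between representations whose values are already proved equal
(multipleZeta_dual, multipleZeta_mul, multipleZeta_two_one_one_eq_add, …); no numerical independence
is proved or used. It bites only on the Target RationalKernel (⟺ S), conceded, and appears honestly
as the HYPOTHESIS of SectorAssembly (Hoffman independence ⟺ Zagier's conjecture given Brown).
- Literature.Barriers.KontsevichZagierPeriods.kzConjecture_implies_twoPiI_log_algIndep: same — no
crux implies independence of 2πi and log q; only the Target does (conceded).
- Literature.Barriers.KontsevichZagierPeriods.kzConjecture_implies_ellipticPeriods_algIndep: same;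
the route never leaves the mixed Tate sector except in the Target.
- Literature.Barriers.KontsevichZagierPeriods.noSemialgebraicPrimitive_inv_sub_two: relevant to
provers of HoffmanRegularisation/EulerBasel who would integrate out one variable of ∏ dtᵢ/(tᵢ − εᵢ)
by an antiderivative in that variable (log-type primitives are not semialgebraic); the intended
lines use Newton–Leibniz only with rational primitives in an AUXILIARY variable (F = t·f for
TorsionFree; sector areas for arctan values) plus cutting and algebraic changes of variables
(Soudères' blow-ups), which the ba

History (route lifecycle, newest last):
- 2026-08-16T04:07:52Z · AUTO-CRUX (backfill): RationalKernel — hypotheses of the deciding theorem that nothing in the route derives are cruxes (operator:999:1085951)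
- 2026-08-24T15:50:51Z · DORMANT — reconciler: no traction for 6.9 d (last activity item-evidence-added at 2026-08-17T18:17:02Z); parked, not closed — `ledger route dormant route-KontsevichZagier (operator:999:2044488)

sub-problem: KontsevichZagierPeriods · status: dormant · opened planner-plancard-KontsevichZagierPeriods-Kont-1f9159fd-0 2026-08-15T11:12:20Z · rev 6 · ledger route-KontsevichZagierPeriods-CoactionDevissage
GENERATED by the gate from the ledger (D-0016/17). Provers cite these decls: `theorem foo : Summit.KontsevichZagierPeriods.KontsevichZagierPeriods.Theses.CoactionDevissage.<Decl> := …` in Summits/KontsevichZagierPeriods/KontsevichZagierPeriods/Theorems/<Name>.lean.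
-/

namespace Summit.KontsevichZagierPeriods.KontsevichZagierPeriods.Theses.CoactionDevissage

open scoped BigOperators Topology Manifold Classical MeasureTheory ProbabilityTheory Matrix InnerProductSpace ComplexConjugate ContinuousMap
open Filter Set Function TopologicalSpace MeasureTheory

attribute [summit_statement] _root_.KontsevichZagierPeriods

open Literature Periods

/-- item stmt-KontsevichZagierPeriods-3165 · crux (kind.auto-crux: conjecture-grade) · rank 0 · open · by planner
why it might fail: Period-conjecture strength (⟺ S by TorsionFree): false as soon as the fixed 4-move calculus misses one motivic relation (HuberMullerStach2017 Rem 13.1.8) — route Neg's bet.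
sources: KontsevichZagier2001, HuberMullerStach2017, Ayoub2014, Brown2012
[target] the Kontsevich–Zagier conjecture with ℚ-coefficients: every c : KZ.FormalRep with KZ.eval c
= 0 has some n ≠ 0 with n • c ∈ KZ.relations (injectivity of P_KZ ⊗ ℚ → ℝ); ⟺ S given TorsionFree. -/
@[route_item "route-KontsevichZagierPeriods-CoactionDevissage", crux]
def RationalKernel : Prop :=
  ∀ c : Literature.NumberTheory.Transcendental.KZ.FormalRep, Literature.NumberTheory.Transcendental.KZ.eval c = 0 → ∃ n : ℕ, n ≠ 0 ∧ n • c ∈ Literature.NumberTheory.Transcendental.KZ.relations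

/-- item stmt-KontsevichZagierPeriods-3166 · crux · rank 2 · open · by planner
why it might fail: Rules may be weaker than motives (HMS Rem 13.1.8): beyond finite double shuffle every known engine regularises divergent words, and even granting all of EDS inside KZ, 'EDS ⇒ Hoffman words span' is open combinatorics (computer-checked only to weight ≈ 20).
sources: Brown2012, arXiv:1102.1310, HuberMullerStach2017, IharaKanekoZagier2006, Hoffman1997, arXiv:2406.13630
[crux] 'rules ≡ motives' on the MZV sector in Hoffman form: for every admissible index s there are N
≠ 0 and a finite ℤ-combination of simplex representations mzvRep t of Hoffman indices t ∈ {2,3}^× of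
the same weight with N • [mzvRep s] − Σ b_t • [mzvRep t] ∈ KZ.relations (Brown2012 Thm 1.1
guarantees the real/motivic decomposition; the crux is that the four moves realise it). Card items
D2/D3 recast. [deps: HoffmanRegularisation, Stuffle, Shuffle, Duality] [difficulty: open-problem] -/
@[route_item "route-KontsevichZagierPeriods-CoactionDevissage"]
def HoffmanSpan : Prop :=
  let ρ : List ℕ → Literature.NumberTheory.Transcendental.KZ.FormalRep := fun u => if h : Literature.NumberTheory.Transcendental.MZV.IsAdmissible u then Literature.NumberTheory.Transcendental.KZ.of (Literature.NumberTheory.Transcendental.KZ.mzvRep u h (Literature.NumberTheory.Transcendental.KZ.mzvIntegrand_isSemialgebraicFunOn_holds u) (Literature.NumberTheory.Transcendental.KZ.mzvIntegrand_integrableOn_holds u h)) else 0; ∀ s : List ℕ, Literature.NumberTheory.Transcendental.MZV.IsAdmissible s → ∃ (N : ℕ) (L : List (List ℕ × ℤ)), N ≠ 0 ∧ (∀ p ∈ L, Literature.NumberTheory.Transcendental.MZV.IsHoffman p.1 ∧ Literature.NumberTheory.Transcendental.MZV.weight p.1 = Literature.NumberTheory.Transcendental.MZV.weight s) ∧ N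 • ρ s - (L.map fun p => p.2 • ρ p.1).sum ∈ Literature.NumberTheory.Transcendental.KZ.relations

/-- item stmt-KontsevichZagierPeriods-3167 · crux · rank 3 · open · by planner
why it might fail: Every printed proof regularises ζ(1) or rearranges series (Hoffman1992 Thm 5.1, IKZ2006); a move-proof needs a convergent Stokes detour. First live instance ζ(4)=ζ(3,1)+ζ(2,2): in weight 4 finite double shuffle + duality yield only 2 of the 3 rational relations.
sources: Hoffman1992, IharaKanekoZagier2006, arXiv:2406.13630, doi:10.5802/jep.335, KontsevichZagier2001
[crux] Hoffman's relation family lies in KZ.relations: for every admissible s = (s₁,…,s_k)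
(decreasing convention of `multipleZeta`), Σ_l [ζ-rep(s₁,…,s_l+1,…,s_k)] − Σ_l Σ_{j ≤ s_l−2}
[ζ-rep(s₁,…,s_{l−1}, s_l−j, j+1, s_{l+1},…,s_k)] ∈ KZ.relations (Hoffman1992 Thm 5.1; = IKZ's
regularised double shuffle with v = y₁). Instances: s=(2): ζ(3)=ζ(2,1); s=(3): ζ(4)=ζ(3,1)+ζ(2,2);
s=(2,1): ζ(2,1,1)=ζ(3,1)+ζ(2,2). [deps: Duality, Shuffle, Stuffle] [difficulty: L] -/
@[route_item "route-KontsevichZagierPeriods-CoactionDevissage"]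
def HoffmanRegularisation : Prop :=
  let ρ : List ℕ → Literature.NumberTheory.Transcendental.KZ.FormalRep := fun u => if h : Literature.NumberTheory.Transcendental.MZV.IsAdmissible u then Literature.NumberTheory.Transcendental.KZ.of (Literature.NumberTheory.Transcendental.KZ.mzvRep u h (Literature.NumberTheory.Transcendental.KZ.mzvIntegrand_isSemialgebraicFunOn_holds u) (Literature.NumberTheory.Transcendental.KZ.mzvIntegrand_integrableOn_holds u h)) else 0; ∀ s : List ℕ, Literature.NumberTheory.Transcendental.MZV.IsAdmissible s → (∑ l : Fin s.length, ρ (s.take l.1 ++ [s.get l + 1] ++ s.drop (l.1 + 1))) - (∑ l : Fin s.length, ∑ j ∈ Finset.range (s.get l - 1), ρ (s.take l.1 ++ [s.get l - j, j + 1] ++ s.drop (l.1 + 1))) ∈ Literature.NumberTheory.Transcendental.KZ.relations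

/-- item stmt-KontsevichZagierPeriods-3168 · crux · rank 4 · open · by planner
why it might fail: KZ2001 §1.2 prove I = π²/2 for I = ∫∫(xy)^{-1/2}(1−xy)^{-1} by rules but identify I = 3ζ(2) by a SERIES expansion; the residual accessible identity ∫∫_{[0,1]²}(1−3uv)/(1−u²v²) = 0 and the arctan ↔ sector-area steps must themselves be moves.
sources: KontsevichZagier2001, BeukersCalabiKolk1993, paper:url-4812d7ce6862
[crux] Euler's ζ(2) = π²/6 inside the calculus: 6 • [ζ(2)-simplex rep] − [disc]·[disc] ∈
KZ.relations, where [disc] = KZ.piRep (closed unit disc, integrand 1) and · is the product of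
representations (KZProduct). The pure/invariant part of the sector (card D3): it ties the MZV
fragment to the [π]-powers of the rest of P_KZ. [difficulty: M] -/
@[route_item "route-KontsevichZagierPeriods-CoactionDevissage"]
def EulerBasel : Prop :=
  let ρ : List ℕ → Literature.NumberTheory.Transcendental.KZ.FormalRep := fun u => if h : Literature.NumberTheory.Transcendental.MZV.IsAdmissible u then Literature.NumberTheory.Transcendental.KZ.of (Literature.NumberTheory.Transcendental.KZ.mzvRep u h (Literature.NumberTheory.Transcendental.KZ.mzvIntegrand_isSemialgebraicFunOn_holds u) (Literature.NumberTheory.Transcendental.KZ.mzvIntegrand_integrableOn_holds u h)) else 0; 6 • ρ [2] - Literature.NumberTheory.Transcendental.KZ.of Literature.NumberTheory.Transcendental.KZ.piRep * Literature.NumberTheory.Transcendental.KZ.of Literature.NumberTheory.Transcendental.KZ.piRep ∈ Literature.NumberTheory.Transcendental.KZ.relations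

/-- item stmt-KontsevichZagierPeriods-17978 · crux · rank 5 · open · by planner
why it might fail: Only if some absolutely convergent ℚ-semialgebraic integral resists resolution INSIDE the rules: a blow-up/ramification chart that is not ONE injective differentiable ℚ-semialgebraic rule-(2) instance on an open piece, or boundary exponents not cleared by τᴺ (value-level it is a theorem).
sources: KontsevichZagier2001, Ayoub2014, HuberMullerStachPeriods2017, Hironaka1964, BierstoneMilman1988, Parusinski1994
[crux] CUBE RESOLUTION — GEOMETRY INSIDE THE RULES (piece X₁ of the BC2-redirect split of the rank-0
target ReductionRigidity, crux-strategist re-audit r1, 2026-08-17): every integral representation of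
the H21 calculus is congruent modulo KZ.relations to a ℤ-combination of TAME CUBE classes [[0,1]ⁿ,
f], f real analytic on a neighbourhood of the closed cube — Ayoub's compact presentation (Ayoub2014
Def 9–10, Prop 11; HMS 2017 Thm 12.2.1 at the level of VALUES) realised by MOVES: compactification,
cell decomposition and Nash charts of cells (rules 1a, 2), then embedded resolution /
rectilinearisation of the boundary singularities of the Nash integrands by blow-up charts and power
substitutions t = τᴺ as rule-(2) instances on open pieces, absolute integrability forcing the
exponents ≥ 0 after τᴺ. Transcendence-free, Hironaka strength, XL. Byte-identical up to unfolding
(cube = {x | ∀ i, 0 ≤ x i ∧ x i ≤ 1} = KZ.cube = ReducedPeriodRing.unitCube, span =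
ReducedPeriodRing.cubicalSpan) with the registered stubs stub_cubeResolution S1 of crux stmt-10813
(FurushoPentagon.SectorToKernel) and S1b of crux stmt-3929 (ReducedPeriodRing) — ONE statement
staffed hub-wide; implied verbatim by item -/
@[route_item "route-KontsevichZagierPeriods-CoactionDevissage"]
def CubeResolution : Prop :=
  ∀ (N : ℕ) (u : Literature.NumberTheory.Transcendental.KZ.IntegralRep N), ∃ c ∈ AddSubgroup.closure {d : Literature.NumberTheory.Transcendental.KZ.FormalRep | ∃ (n : ℕ) (r : Literature.NumberTheory.Transcendental.KZ.IntegralRep n), r.domain = {x : Fin n → ℝ | ∀ i, 0 ≤ x i ∧ x i ≤ 1} ∧ AnalyticOnNhd ℝ r.integrand {x : Fin n → ℝ | ∀ i, 0 ≤ x i ∧ x i ≤ 1} ∧ d = Literature.NumberTheory.Transcendental.KZ.of r}, Literature.NumberTheory.Transcendental.KZ.of u - c ∈ Literature.NumberTheory.Transcendental.KZ.relations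

/-- item stmt-KontsevichZagierPeriods-18116 · crux · rank 6 · open · by planner
why it might fail: Period-conjecture strength in kind (Ayoub2015 Fait 1.4; GPC-type consequences); false iff ONE algebraic power series of polyradius > 1 with ∫ = 0 lies outside the ℚ-span of Stokes elements in every number of extra variables (Rem 1.2: with the variable count fixed it IS false).
sources: Ayoub2015, Fresan2024, Ayoub2014, AyoubRelKZRevisited, HuberWustholz2022
[crux] AYOUB'S EFFECTIVE CUBE CONJECTURE at k = ℚ (piece X₂ of the BC2-redirect split of
ReductionRigidity, crux-strategist r1; PRINTED: J. Ayoub, Ann. of Math. 181 (2015) Conj. 1.1 = J.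
Fresán, X-UPS 2024 Conj. 3.5): the kernel of ∫_{[0,1]^∞} on 𝒪_{ℚ-alg}(𝔻̄^∞) — power series in
finitely many variables, polyradius of convergence > 1, algebraic over ℚ(z) (AyoubRel.Oan
(Rat.castHom ℂ), AyoubRel.intC) — is the ℚ-span (AyoubRel.kSpan) of the type-(a) elements ∂G/∂zᵢ −
G|_{zᵢ=1} + G|_{zᵢ=0} (AyoubRel.relAC i G). Conjecture 1's TRANSCENDENCE content in Ayoub's LINEAR
presentation: one filtered function space, n commuting operators ∂ᵢ and the face restrictions, no
domains, no semialgebraic geometry, no rule (2); ⊇ is the tree theorem AyoubRel.intC_relAC_eq_zero;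
the RELATIVE version is a THEOREM (AyoubRelKZRevisited Thm 1.11, tree fact
ayoub_integration_injective_localized: injective after inverting 2πi); the variable count cannot be
bounded (Ayoub Rem 1.2; tree: kernelElt_not_stokes_one_variable). Verbatim the registered stub
stub_ayoubEffectiveCubeKernel S6 of crux stmt-10813; ⇔ the summit-side @[conjecture] leaf
TypeAGenerationConjecture (AyoubRel.typeAGeneration_forall_iff_rat, algeb -/
@[route_item "route-KontsevichZagierPeriods-CoactionDevissage"]
def AyoubEffectiveCubeKernel : Prop :=
  ∀ F ∈ Literature.NumberTheory.Transcendental.AyoubRel.Oan (Rat.castHom ℂ), Literature.NumberTheory.Transcendental.AyoubRel.intC F = 0 → F ∈ Literature.NumberTheory.Transcendental.AyoubRel.kSpan (Rat.castHom ℂ) {x : Literature.NumberTheory.Transcendental.AyoubRel.CSeries | ∃ G ∈ Literature.NumberTheory.Transcendental.AyoubRel.Oan (Rat.castHom ℂ), ∃ i : ℕ, x = Literature.NumberTheory.Transcendental.AyoubRel.relAC i G}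

/-- item stmt-KontsevichZagierPeriods-14273 · crux (kind.auto-crux: conjecture-grade) · rank 9 · open · by planner
why it might fail: Summit-strength complement: false as soon as the four-move calculus misses one relation among NON-MZV representations (HuberMullerStach2017 Rem 13.1.8; route Neg), even with every sector crux proved; inside the span it needs Hoffman independence (open).
sources: KontsevichZagier2001, HuberMullerStach2017, Brown2012, Ayoub2014, IharaKanekoZagier2006
[support] SectorToRationalKernel — COMPLEMENT of the MZV sector: the glue closing the target's type
(gate hold route.target-unreachable 2026-08-16, operator route-choice option (a) 'add glue item(s)
Crux… → RationalKernel'). Statement: the three typed sector cruxes HoffmanSpan ∧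
HoffmanRegularisation ∧ EulerBasel imply the Target RationalKernel (the period conjecture for P_KZ ⊗
ℚ: KZ.eval c = 0 ⇒ ∃ n ≠ 0, n • c ∈ KZ.relations). HONEST STATUS: open problem, summit-strength —
the antecedents are KZ-equivalences between representations whose values are already proved equal,
so given them this item is equivalent to RationalKernel itself (⟺ S by TorsionFree / `closes`); it
is NOT reached by the route's mechanism (Brown's coaction dévissage delivers relations only inside
the mixed Tate / MZV sector). What it consists of: (i) inside the span ℤ⟨[mzvRep s]⟩ it is exactly
the transcendence hypothesis of SectorAssembly (ℚ-linear independence of the real Hoffman values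
ζ(t), t ∈ {2,3}^× ⟺ Zagier's conjecture given Brown2012 Thm 1.1) — SectorAssembly (provable now) +
HoffmanSpan + TorsionFree settle that case from it, and EulerBasel only ties [disc]² to the span;
(ii) outside the span (log 2, π -/
@[route_item "route-KontsevichZagierPeriods-CoactionDevissage"]
def SectorToRationalKernel : Prop :=
  HoffmanSpan → HoffmanRegularisation → EulerBasel → RationalKernel

-- item stmt-KontsevichZagierPeriods-3211 · support · rank 5 · open · by planner — informal only, no Lean statement yet:
--   [crux] (coaction-proper structural statement of card kz-coaction-devissage D1, recast
--   non-circularly; informal until the definition request GoncharovFormalIteratedIntegrals lands) Let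
--   𝔥⁰_ℚ be the convergent shuffle algebra of words in {ω₀, ω₁} (IharaKanekoZagier2006), identified with
--   the regularised quotient of Goncharov's Hopf algebra 𝓘_•({0,1}) of formal iterated integrals
--   (arXiv:math/0208144 §2: symbols 𝕀(a₀;a₁…a_n;a_{n+1}) modulo path composition, shuffle, triviality,
--   reversal; coproduct Δ𝕀(a₀;…;a_{n+1}) = Σ 𝕀(a₀;a_{i₁},…,a_{i_k};a_{n+1}) ⊗ Π_p
--   𝕀(a_{i_p};a_{i_p+1},…;a_{i_{p+1}})), and let

/-- item stmt-KontsevichZagierPeriods-17690 · support · rank 9 · closed · proved by Summit.KontsevichZagierPeriods.CoactionDevissage.rationalKernelOfCubes_proof @ 854c0c03c5bb (prover) · by planner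
[support] SPLIT GLUE of the deciding crux RationalKernel (crux-strategist RESTATED re-audit r1, BC2
REDIRECT along Ayoub's compact presentation; the two children dedup onto the hub-wide items
stmt-17978 / stmt-18116): CubeResolution → AyoubEffectiveCubeKernel → RationalKernel. PROVED
sorry-free against the route decl BY NAME with the children written out (planner file
CoactionDevissageRationalKernelSplit.lean, `RationalKernel_of_subs`, lean check rc0, 0 sorries,
axioms {propext, Classical.choice, Quot.sound}; attached as evidence on stmt-3165 and on this item —
Summits/Theorems is prover-only, so a prover re-lands it as
Theorems/CoactionDevissageRationalKernelSplit.lean, exactly as HermiteRigidity's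
ReductionRigidityOfCubes stmt-18142). THE SEAM is the landed seven-step TRANSFER
FurushoPentagon.SectorToKernel.kzKernel_of_cubeResolution_of_ayoubKernel
(Theorems/FurushoPentagonSectorToKernelOfLeaves.lean): resolve a vanishing formal combination into
the tame cubical span (CubeResolution), MERGE to one tame cube class
(ReducedPeriodRing.stub_cubeMerge, landed p77291), make it Ayoub-ADMISSIBLE inside the moves
(stub_admissibleOfTame, p91241), ∫ = 0 by SOUNDNESS (KZ.relations_le_ker_eva -/
@[route_item "route-KontsevichZagierPeriods-CoactionDevissage"]
def RationalKernelOfCubes : Prop :=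
  CubeResolution → AyoubEffectiveCubeKernel → RationalKernel

/-- item stmt-KontsevichZagierPeriods-3169 · support · rank 9 · closed · proved by Summit.KontsevichZagierPeriods.CoactionDevissage.TorsionFree.exceptionalCouplings_torsionFree_proof @ f648441f8c8f (prover) · by planner
sources: KontsevichZagier2001, Literature.NumberTheory.Transcendental.KZ.mul_mem_relations_right_holds, Literature.NumberTheory.Transcendental.KZ.of_mul_of
[support] P_KZ is torsion-free: n ≠ 0, n • c ∈ KZ.relations ⇒ c ∈ KZ.relations. Proof: c − c·[0,1] ∈
relations (Newton–Leibniz on each generator r with base r, band r.domain × [0,1] = (r.prod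
I₀₁).domain, F(x,t) = t·f(x)); c·[0,1] − n • (c·[0,1/n]) ∈ relations (domain additivity into n slabs
over the null overlaps r.domain × {k/n}, translations t ↦ t − k/n as changes of variables); n •
(c·[0,1/n]) = (n • c)·[0,1/n] ∈ relations by `KZ.mul_mem_relations_right_holds`. Card item D0.
[difficulty: provable-now] -/
@[route_item "route-KontsevichZagierPeriods-CoactionDevissage", crux]
def TorsionFree : Prop :=
  ∀ (n : ℕ) (c : Literature.NumberTheory.Transcendental.KZ.FormalRep), n ≠ 0 → n • c ∈ Literature.NumberTheory.Transcendental.KZ.relations → c ∈ Literature.NumberTheory.Transcendental.KZ.relations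

/-- item stmt-KontsevichZagierPeriods-3170 · support · rank 9 · closed · proved by Summit.KontsevichZagierPeriods.CoactionDevissage.divisible_proof @ c9dd7445af57 (prover) · by planner
sources: KontsevichZagier2001, Literature.NumberTheory.Transcendental.KZ.mul_mem_relations_right_holds
[support] P_KZ is divisible: for n ≠ 0 every c has c' with c − n • c' ∈ KZ.relations (c' :=
c·[0,1/n]; same two steps as TorsionFree). With TorsionFree, P_KZ is uniquely divisible, i.e. a
ℚ-vector space — so ℚ-linear transfer maps (route NoriTransfer, refuted when typed into the free
group FormalRep: Theorems/NoriTransferRefutations.lean) can target P_KZ instead. [difficulty: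
provable-now] -/
@[route_item "route-KontsevichZagierPeriods-CoactionDevissage"]
def Divisible : Prop :=
  ∀ (n : ℕ) (c : Literature.NumberTheory.Transcendental.KZ.FormalRep), n ≠ 0 → ∃ c' : Literature.NumberTheory.Transcendental.KZ.FormalRep, c - n • c' ∈ Literature.NumberTheory.Transcendental.KZ.relations

/-- item stmt-KontsevichZagierPeriods-3171 · support · rank 9 · closed · proved by Summit.KontsevichZagierPeriods.CoactionDevissage.duality_proof @ d607e6088f31 (prover) · by planner
sources: Zagier1994, Literature.NumberTheory.Transcendental.multipleZeta_dual, Literature.NumberTheory.Transcendental.KZ.measurePreserving_dualMap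
[support] duality is one move: [mzvRep s] − [mzvRep (dual s)] ∈ KZ.relations by the change of
variables tᵢ ↦ 1 − t_{w−1−i} of the open ordered simplex (|det| = 1; `MultipleZetaDuality.dualMap`),
which swaps ω₀ ↔ ω₁ and reverses the word. Gives ζ(3) = ζ(2,1), ζ(2,1,1) = ζ(4), … as
KZ-equivalences. [difficulty: provable-now] -/
@[route_item "route-KontsevichZagierPeriods-CoactionDevissage"]
def Duality : Prop :=
  let ρ : List ℕ → Literature.NumberTheory.Transcendental.KZ.FormalRep := fun u => if h : Literature.NumberTheory.Transcendental.MZV.IsAdmissible u then Literature.NumberTheory.Transcendental.KZ.of (Literature.NumberTheory.Transcendental.KZ.mzvRep u h (Literature.NumberTheory.Transcendental.KZ.mzvIntegrand_isSemialgebraicFunOn_holds u) (Literature.NumberTheory.Transcendental.KZ.mzvIntegrand_integrableOn_holds u h)) else 0; ∀ s : List ℕ, Literature.NumberTheory.Transcendental.MZV.IsAdmissible s → ρ s - ρ (Literature.NumberTheory.Transcendental.MZV.dual s) ∈ Literature.NumberTheory.Transcendental.KZ.relations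

/-- item stmt-KontsevichZagierPeriods-3172 · support · rank 9 · closed · proved by Summit.KontsevichZagierPeriods.CoactionDevissage.shuffle_proof @ b1c3635b842c (prover) · by planner
sources: arXiv:0808.0248, Literature.NumberTheory.Transcendental.multipleZeta_mul_eq_sum_shuffleWord, KontsevichZagier2001
[support] the shuffle product is realised by moves: [mzvRep s]·[mzvRep t] − Σ_{w ∈ sh(word s, word
t)} [mzvRep (index of w)] ∈ KZ.relations — product rep = rep on Δ_p × Δ_q (KZ.of_mul_of), domain
additivity into the simplices indexed by shuffles (pairwise overlaps Lebesgue-null), coordinate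
permutations as changes of variables (arXiv:0808.0248 §1.2; the real identity is
`multipleZeta_mul_eq_sum_shuffleWord`). [difficulty: provable-now] -/
@[route_item "route-KontsevichZagierPeriods-CoactionDevissage"]
def Shuffle : Prop :=
  let ρ : List ℕ → Literature.NumberTheory.Transcendental.KZ.FormalRep := fun u => if h : Literature.NumberTheory.Transcendental.MZV.IsAdmissible u then Literature.NumberTheory.Transcendental.KZ.of (Literature.NumberTheory.Transcendental.KZ.mzvRep u h (Literature.NumberTheory.Transcendental.KZ.mzvIntegrand_isSemialgebraicFunOn_holds u) (Literature.NumberTheory.Transcendental.KZ.mzvIntegrand_integrableOn_holds u h)) else 0; ∀ s t : List ℕ, Literature.NumberTheory.Transcendental.MZV.IsAdmissible s → Literature.NumberTheory.Transcendental.MZV.IsAdmissible t → ρ s * ρ t - ((Literature.NumberTheory.Transcendental.MZV.shuffleWord (Literature.NumberTheory.Transcendental.MZV.binaryWord s) (Literature.NumberTheory.Transcendental.MZV.binaryWord t)).map fun w => ρ (Literature.NumberTheory.Transcendental.MZV.ofBinaryWord w)).sum ∈ Literature.NumberTheory.Transcendental.KZ.relations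

/-- item stmt-KontsevichZagierPeriods-3173 · support · rank 9 · closed · proved by Summit.KontsevichZagierPeriods.CoactionDevissage.stuffle_proof @ a798bede74b2 (prover) · by planner
sources: arXiv:0808.0248, doi:10.1142/s1793042110002995, Hoffman1997, Literature.NumberTheory.Transcendental.multipleZeta_mul
[support] the stuffle (harmonic) product is realised by moves with absolutely convergent
intermediates: [mzvRep s]·[mzvRep t] − Σ_{u ∈ stuffle s t} [mzvRep u] ∈ KZ.relations, by Soudères'
recipe (arXiv:0808.0248 Prop 1.3, 1.5, Cor 1.6, after Goncharov and Brown's thesis): the cubical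
blow-up change of variables t_n = x₁, t_{n−1} = x₁x₂, … (polynomial, injective on the open cube,
polynomial Jacobian) turns ζ-reps into cube integrals of f_k; the pointwise identity f_k(x) f_l(x')
= Σ_σ f_σ(y_σ) with ALL summands positive is integrand additivity; permuting variables is a change
of variables; back to simplices by the inverse blow-up. Contains route Grothendieck's 0275
(ζ(2)∗ζ(2)) combined with Shuffle. [difficulty: L] -/
@[route_item "route-KontsevichZagierPeriods-CoactionDevissage"]
def Stuffle : Prop :=
  let ρ : List ℕ → Literature.NumberTheory.Transcendental.KZ.FormalRep := fun u => if h : Literature.NumberTheory.Transcendental.MZV.IsAdmissible u then Literature.NumberTheory.Transcendental.KZ.of (Literature.NumberTheory.Transcendental.KZ.mzvRep u h (Literature.NumberTheory.Transcendental.KZ.mzvIntegrand_isSemialgebraicFunOn_holds u) (Literature.NumberTheory.Transcendental.KZ.mzvIntegrand_integrableOn_holds u h)) else 0; ∀ s t : List ℕ, Literature.NumberTheory.Transcendental.MZV.IsAdmissible s → Literature.NumberTheory.Transcendental.MZV.IsAdmissible t → ρ s * ρ t - ((Literature.NumberTheory.Transcendental.MZV.stuffle s t).map ρ).sum ∈ 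Literature.NumberTheory.Transcendental.KZ.relations

/-- item stmt-KontsevichZagierPeriods-3174 · support · rank 9 · closed · proved by Summit.KontsevichZagierPeriods.CoactionDevissage.sectorAssembly_proof @ 647b34c5b5c8 (prover) · by planner
sources: Brown2012, ZagierECM1994, Literature.NumberTheory.Transcendental.KZ.mzvRep_value_holds, Literature.NumberTheory.Transcendental.KZ.relations_le_ker_eval_holds
[support] the MZV-sector theorem with transcendence isolated: HoffmanSpan → TorsionFree → (the real
Hoffman values ζ(t), t ∈ {2,3}^×, are ℚ-linearly independent; ⟺ Zagier's conjecture given Brown2012)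
→ every c in the subgroup of FormalRep generated by the simplex reps [mzvRep s] with KZ.eval c = 0
lies in KZ.relations. Pure algebra: multiply c by the product of the N's, rewrite in Hoffman reps
mod relations, evaluate with `KZ.mzvRep_value_holds` and `KZ.relations_le_ker_eval_holds`, kill the
integer coefficients by independence, divide by TorsionFree. [difficulty: provable-now] -/
@[route_item "route-KontsevichZagierPeriods-CoactionDevissage"]
def SectorAssembly : Prop :=
  let ρ : List ℕ → Literature.NumberTheory.Transcendental.KZ.FormalRep := fun u => if h : Literature.NumberTheory.Transcendental.MZV.IsAdmissible u then Literature.NumberTheory.Transcendental.KZ.of (Literature.NumberTheory.Transcendental.KZ.mzvRep u h (Literature.NumberTheory.Transcendental.KZ.mzvIntegrand_isSemialgebraicFunOn_holds u) (Literature.NumberTheory.Transcendental.KZ.mzvIntegrand_integrableOn_holds u h)) else 0; HoffmanSpan → TorsionFree → LinearIndependent ℚ (fun s : {s : List ℕ // Literature.NumberTheory.Transcendental.MZV.IsHoffman s} => Literature.NumberTheory.Transcendental.multipleZeta s.1) → ∀ c ∈ AddSubgroup.closure (Set.range ρ), Literature.NumberTheory.Transcendental.KZ.eval c = 0 → c ∈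 Literature.NumberTheory.Transcendental.KZ.relations

/-- item stmt-KontsevichZagierPeriods-3175 · assembly · rank 1 · closed · proved by Summit.KontsevichZagierPeriods.GenusOneIterated.assembly_proof @ b4d8d8c49355 (prover) · by planner
sources: KontsevichZagier2001, HuberMullerStach2017
[assembly] TorsionFree → RationalKernel → KontsevichZagierPeriods. -/
@[route_item "route-KontsevichZagierPeriods-CoactionDevissage"]
def Assembly : Prop :=
  TorsionFree → RationalKernel → KontsevichZagierPeriods

/-! D-0027 §2.1 — DECIDING THEOREM (planner-authored via `route open/edit --closes-file`; by planner-rbadge-KontsevichZagierPeriods-Coactio-04fd658d-g2-0 2026-08-15T16:13:34Z):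
its hypotheses are this route's items and its conclusion the sub-problem Statement (glue_lint), and it elaborates with this file. -/

@[closes "route-KontsevichZagierPeriods-CoactionDevissage"] theorem closes (hT : TorsionFree) (hR : RationalKernel) : KontsevichZagierPeriods := by
  intro n m r r' _ _ hv
  obtain ⟨k, hk, hkc⟩ := hR
    (Literature.NumberTheory.Transcendental.KZ.of r - Literature.NumberTheory.Transcendental.KZ.of r')
    (by simp [Literature.NumberTheory.Transcendental.KZ.eval_of, hv])
  exact hT k (Literature.NumberTheory.Transcendental.KZ.of r - Literature.NumberTheory.Transcendental.KZ.of r') hk hkc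

end Summit.KontsevichZagierPeriods.KontsevichZagierPeriods.Theses.CoactionDevissage
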